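import Literature.AlgebraicGeometry.Motives.EllAdicCohomologyModuleFiniteness
import HarnessLib

/-!
# `exists_module_finite_ellAdicCohomology_of_finite` from the comparison facts

The last named fact of `EllAdicCohomologyFiniteness.lean` that was not yet tied to the shared
trust base of the `ℓ`-adic finiteness cluster,
`Literature.AlgebraicGeometry.Motives.exists_module_finite_ellAdicCohomology_of_finite`
(for a locally Noetherian scheme `Y` and a prime `ℓ` with all `Hʲ(Y_proét, ℤ/ℓᵐ)` finite, every
`Hⁱ_proét(Y, ℤ_ℓ)` admits a finitely generated `ℤ_ℓ`-module structure; Bhatt–Scholze Prop. 5.6.2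
with Milne V Lemma 1.11), is proved here from

* `ellAdicCohomology_limOneSequence` — Bhatt–Scholze Prop. 5.6.2 (`EllAdicComparison.lean`), and
* `nonempty_addEquiv_proetCohomology_etaleCohomology` — Bhatt–Scholze Cor. 5.1.6, the bridge
  `Hʲ(Y_proét, ℤ/n) ≅ Hʲ(Y_ét, ℤ/n)` (`EllAdicCohomologyFinitenessEtale.lean`),

Milne V Lemma 1.11 being proved (`module_finite_towerLim_etaleCohomology`, `EllAdicBockstein.lean`):
`exists_module_finite_ellAdicCohomology_of_finite_of_comparison_of_bridge`. Degrees `j + 1` go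
as in `EllAdicCohomologyModuleFiniteness.lean`. Degree `0` is unconditional and purely
topological: `H⁰(Y_proét, F_A) = C(Y, A)` (`proetCohomologyZeroEquiv`), finiteness of
`C(Y, ℤ/ℓ)` forces `Y` to have finitely many clopen subsets
(`finite_clopens_of_finite_continuousMap`), and then `C(Y, ℤ_ℓ)` embeds `ℤ_ℓ`-linearly into the
finite product of copies of `ℤ_ℓ` indexed by the clopen subsets, a continuous map to the totally
separated `ℤ_ℓ` being constant on each atom of the finite Boolean algebra of clopens
(`module_finite_continuousMap_of_finite_clopens`).

## References

* B. Bhatt, P. Scholze, *The pro-étale topology for schemes*, Astérisque 369 (2015), Lemma 4.2.12,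
  Cor. 5.1.6, Prop. 5.6.2. [BhattScholze2015]
* J. S. Milne, *Étale cohomology* (2025 reissue), V Lemma 1.11, p. 177. [Milne2025]
-/

noncomputable section

open scoped Classical

universe u v w

open CategoryTheory AlgebraicGeometry

namespace Literature.AlgebraicGeometry.Motives

/-! ### Spaces with finitely many clopen subsets -/

section Clopens

variable {Y : Type v} [TopologicalSpace Y]

/-- If the continuous maps from `Y` to a space `B` with two distinct points form a finite set,
then `Y` has only finitely many clopen subsets (a clopen set is recovered from its
`B`-valued indicator function, which is continuous). [folklore] -/
theorem finite_clopens_of_finite_continuousMap {B : Type w} [TopologicalSpace B] {b₀ b₁ : B}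
    (hb : b₀ ≠ b₁) [Finite C(Y, B)] : Finite {U : Set Y // IsClopen U} := by
  refine Finite.of_injective (fun U : {U : Set Y // IsClopen U} =>
    (⟨U.1.piecewise (fun _ => b₁) (fun _ => b₀), continuous_piecewise
      (fun a ha => by simp [U.2.frontier_eq] at ha) continuousOn_const continuousOn_const⟩ :
      C(Y, B))) fun U V hUV => ?_
  have hy : ∀ y, U.1.piecewise (fun _ => b₁) (fun _ => b₀) y =
      V.1.piecewise (fun _ => b₁) (fun _ => b₀) y := fun y =>
    congrArg (fun g : C(Y, B) => g y) hUV
  refine Subtype.ext (Set.ext fun y => ⟨fun hyU => ?_, fun hyV => ?_⟩)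
  · by_contra hyV
    have := hy y
    rw [Set.piecewise_eq_of_mem _ _ _ hyU, Set.piecewise_eq_of_notMem _ _ _ hyV] at this
    exact hb this.symm
  · by_contra hyU
    have := hy y
    rw [Set.piecewise_eq_of_notMem _ _ _ hyU, Set.piecewise_eq_of_mem _ _ _ hyV] at this
    exact hb this

/-- A continuous map to a totally separated space takes the same value at two points that lie
in the same clopen subsets. [folklore] -/
theorem apply_eq_apply_of_forall_isClopen {T : Type w} [TopologicalSpace T]
    [TotallySeparatedSpace T] (g : C(Y, T)) {y y' : Y}
    (h : ∀ U : Set Y, IsClopen U → y ∈ U → y' ∈ U) : g y' = g y := by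
  by_contra hne
  obtain ⟨V, hV, hyV, hy'V⟩ := exists_isClopen_of_totally_separated (Ne.symm hne)
  exact hy'V (h (g ⁻¹' V) (hV.preimage g.continuous) hyV)

/-- If `Y` has finitely many clopen subsets, `C(Y, ℤ_ℓ)` is a finitely generated `ℤ_ℓ`-module:
evaluation at a point of each non-empty clopen subset is an injective `ℤ_ℓ`-linear map into a
finite free module, because a continuous map to the totally separated `ℤ_ℓ` is constant on the
atom `⋂ {U clopen ∋ y}` of each point `y` (itself a clopen subset). [folklore] -/
theorem module_finite_continuousMap_of_finite_clopens [Finite {U : Set Y // IsClopen U}]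
    (ℓ : ℕ) [Fact ℓ.Prime] : Module.Finite ℤ_[ℓ] C(Y, ℤ_[ℓ]) := by
  let Φ : C(Y, ℤ_[ℓ]) →ₗ[ℤ_[ℓ]] ({U : Set Y // IsClopen U} → ℤ_[ℓ]) :=
    { toFun := fun g U => if hU : U.1.Nonempty then g hU.some else 0
      map_add' := fun g g' => by
        funext U
        by_cases hU : U.1.Nonempty
        · simp only [dif_pos hU, Pi.add_apply, ContinuousMap.add_apply]
        · simp only [dif_neg hU, Pi.add_apply, add_zero]
      map_smul' := fun c g => by
        funext U
        by_cases hU : U.1.Nonempty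
        · simp only [dif_pos hU, Pi.smul_apply, ContinuousMap.smul_apply, RingHom.id_apply]
        · simp only [dif_neg hU, Pi.smul_apply, smul_zero, RingHom.id_apply] }
  refine Module.Finite.of_injective Φ fun g g' hgg' => ?_
  ext y
  -- the atom of `y` in the finite Boolean algebra of clopen subsets
  let A : Set Y := ⋂ U : {U : {U : Set Y // IsClopen U} // y ∈ U.1}, U.1.1
  have hA : IsClopen A := isClopen_iInter_of_finite fun U => U.1.2
  have hAne : A.Nonempty := ⟨y, Set.mem_iInter.2 fun U => U.2⟩
  have hsub : ∀ U : Set Y, IsClopen U → y ∈ U → A ⊆ U := fun U hU hyU =>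
    Set.iInter_subset (fun U : {U : {U : Set Y // IsClopen U} // y ∈ U.1} => U.1.1)
      ⟨⟨U, hU⟩, hyU⟩
  have key : ∀ g : C(Y, ℤ_[ℓ]), g hAne.some = g y := fun g =>
    apply_eq_apply_of_forall_isClopen g fun U hU hyU => hsub U hU hyU hAne.some_mem
  have hΦ := congr_fun hgg' ⟨A, hA⟩
  simp only [Φ, LinearMap.coe_mk, AddHom.coe_mk, dif_pos hAne] at hΦ
  rw [← key g, ← key g', hΦ]

/-- If `C(Y, ℤ/q)` is finite for some `q > 1`, then `C(Y, ℤ_ℓ)` is a finitely generated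
`ℤ_ℓ`-module. [folklore] -/
theorem module_finite_continuousMap_of_finite_continuousMap_zmod {q : ℕ} [Fact (1 < q)]
    [Finite C(Y, ZMod q)] (ℓ : ℕ) [Fact ℓ.Prime] : Module.Finite ℤ_[ℓ] C(Y, ℤ_[ℓ]) :=
  haveI := finite_clopens_of_finite_continuousMap (Y := Y) (zero_ne_one : (0 : ZMod q) ≠ 1)
  module_finite_continuousMap_of_finite_clopens ℓ

end Clopens

/-! ### The reduction -/

/-- In an exact pair `δ : L → M`, `ρ : M → N` (`range δ = ker ρ`) with `L` trivial, `ρ` is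
injective. [folklore] -/
theorem injective_of_range_eq_ker {L M N : Type*} [AddCommGroup L] [AddCommGroup M]
    [AddCommGroup N] (δ : L →+ M) (ρ : M →+ N) (h : δ.range = ρ.ker) [Subsingleton L] :
    Function.Injective ρ := by
  refine (injective_iff_map_eq_zero ρ).2 fun x hx => ?_
  have hx' : x ∈ ρ.ker := (AddMonoidHom.mem_ker).2 hx
  rw [← h] at hx'
  obtain ⟨l, rfl⟩ := hx'
  rw [Subsingleton.elim l 0, map_zero]

/-- **`exists_module_finite_ellAdicCohomology_of_finite` from Bhatt–Scholze Prop. 5.6.2 and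
Cor. 5.1.6.** For a scheme `Y` and a prime `ℓ` such that all `Hʲ(Y_proét, ℤ/ℓᵐ)` are finite,
every `Hⁱ_proét(Y, ℤ_ℓ)` admits a finitely generated `ℤ_ℓ`-module structure: the bridge (5.1.6)
makes all `Hʲ(Y_ét, ℤ/ℓᵐ)` finite; in degrees `j + 1` the `lim¹` term of the 5.6.2 sequence
vanishes (Mittag-Leffler), so `Hʲ⁺¹_proét(Y, ℤ_ℓ) ≅ lim_m Hʲ⁺¹(Y_ét, ℤ/ℓᵐ)`, finitely generated by
the proved Milne V Lemma 1.11; in degree `0`, `H⁰_proét(Y, ℤ_ℓ) = C(Y, ℤ_ℓ)` and the finiteness of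
`H⁰(Y_proét, ℤ/ℓ) = C(Y, ℤ/ℓ)` bounds the clopen subsets of `Y`. (The locally-Noetherian
hypothesis of the fact is not used.) [cite: BhattScholze2015, Prop. 5.6.2 and Cor. 5.1.6]
[cite: Milne2025, V Lemma 1.11] -/
theorem exists_module_finite_ellAdicCohomology_of_finite_of_comparison_of_bridge
    (h₃ : ellAdicCohomology_limOneSequence.{u})
    (h₅ : nonempty_addEquiv_proetCohomology_etaleCohomology.{u}) :
    exists_module_finite_ellAdicCohomology_of_finite.{u} := by
  intro Y _ ℓ _ hfin i
  have hfin' : ∀ j m : ℕ, Finite (etaleCohomologyZModPow Y ℓ j m) := fun j m => by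
    obtain ⟨e⟩ := h₅ Y (ℓ ^ m) j
    haveI := hfin m j
    exact Finite.of_equiv _ e.toEquiv
  cases i with
  | zero =>
    haveI : Fact (1 < ℓ ^ 1) := ⟨by rw [pow_one]; exact (Fact.out : ℓ.Prime).one_lt⟩
    haveI : Finite C(↥Y, ZMod (ℓ ^ 1)) := by
      haveI := hfin 1 0
      exact Finite.of_equiv _ (proetCohomologyZeroEquiv Y (ZMod (ℓ ^ 1))).toEquiv
    haveI := module_finite_continuousMap_of_finite_continuousMap_zmod (Y := ↥Y) (q := ℓ ^ 1) ℓ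
    exact exists_module_finite_of_addEquiv (ellAdicCohomologyZeroEquiv Y ℓ)
  | succ j =>
    obtain ⟨δ, ρ, -, hρ, hδρ⟩ := h₃ Y ℓ j
    haveI : ∀ m, Finite (etaleCohomologyZModPow Y ℓ j m) := fun m => hfin' j m
    haveI := subsingleton_towerLimOne_of_finite (etaleCohomologyZModPowMap Y ℓ j)
    obtain ⟨inst, hfg⟩ := module_finite_towerLim_etaleCohomology Y ℓ (j + 1) (hfin' (j + 1))
    exact exists_module_finite_of_addEquiv
      (AddEquiv.ofBijective ρ ⟨injective_of_range_eq_ker δ ρ hδρ, hρ⟩)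

end Literature.AlgebraicGeometry.Motives

end
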